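import Literature.Probability.LatticeModels.GridDomainHittingProbability
import Literature.Analysis.Complex.RiemannMapping
import Mathlib.Analysis.Complex.Schwarz
import HarnessLib

/-!
# Boundary hitting in grid domains (LSW 2004, Lemma 5.3) — proved steps, II:
# lattice steps are small in conformal coordinates near the boundary

Topic `Literature/Probability/LatticeModels`; second sibling of `GridDomainHittingProbability.lean`
(the named fact `boundaryHitting`, Lawler–Schramm–Werner 2004, Lemma 5.3). The last paragraph of
the printed proof (G. F. Lawler, O. Schramm, W. Werner, Ann. Probab. 32 (2004), §5.1, proof of
Lemma 5.3; arXiv math/0112234 p. 28) reads: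

> "The Koebe distortion theorem implies that there is a constant `c > 0` such that if
> `v₁, v₂ ∈ V(D)` are neighbors, then `1 - |ψ_D(v₂)| ≤ c (1 - |ψ_D(v₁)|)`. (See, e.g., Corollaries
> 1.4 and 1.5 in [Pommerenke 1992].) Consequently, we may iterate the above restricted case of the
> lemma and use the Markov property, thereby proving the lemma for arbitrary `ε₂ > 0`."

and its first step uses "`α ∩ C(w, r/8) = ∅`" for `α = {|ψ_D - ψ_D(w)| = ε₁}`, `r = dist(w, ∂D)`,
when `1 - |ψ_D(w)|` is small compared to `ε₁`. This file proves both facts, with explicit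
constants, for every grid domain `D` (`LSWGrid.IsGridDomain`) and every holomorphic `ψ : D → 𝔻`
(injectivity is not needed): the tool is the two-point Schwarz–Pick lemma rather than Koebe's
theorem. Everything is proved, [folklore] or cited to the paper; no definition, no named fact.

* `norm_sub_mul_le_of_mapsTo_ball` — **two-point Schwarz–Pick, Euclidean form**: if `ψ` is
  holomorphic on `B(x, d)` with values in `𝔻` then for `z ∈ B(x, d)`,
  `‖ψ z - ψ x‖ · (d - ‖z - x‖) ≤ ‖z - x‖ · (1 - ‖ψ x‖²)` (Schwarz's lemma for
  `φ_{ψ x} ∘ ψ`, `φ_a` the disc automorphism of `RiemannMapping.lean`); in particular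
  `‖ψ z - ψ x‖ ≤ 1 - ‖ψ x‖²` on `B̄(x, d/2)` (`norm_sub_le_of_mapsTo_ball_half`) — the conformal
  displacement inside the inscribed disc is of the order of the conformal distance to the boundary.
* `LSWGrid.one_le_dist_of_mem_segment` — a lattice point is at distance `≥ 1` from every grid edge
  not ending at it; hence, for a grid domain, `LSWGrid.IsGridDomain.ball_one_subset` — **the open
  unit disc about a lattice point of `D` lies in `D`** (`dist(v, ∂D) ≥ 1` on `V(D)`), and
  `LSWGrid.IsGridDomain.toComplex_mem_frontier` — a lattice neighbour outside `D` of a point of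
  `V(D)` lies ON `∂D` (the walk killed on leaving `V(D)` is the walk stopped at `∂D`).
* `LSWGrid.IsGridDomain.norm_sub_le_of_adj`, `LSWGrid.IsGridDomain.one_sub_norm_le_of_adj` — **for
  lattice neighbours `v₁, v₂ ∈ V(D)`: `‖ψ v₂ - ψ v₁‖ ≤ 14 (1 - ‖ψ v₁‖)` and
  `1 - ‖ψ v₂‖ ≤ 15 (1 - ‖ψ v₁‖)`** (two Schwarz–Pick steps through the midpoint `m` of the edge,
  using `B(v₁, 1) ⊆ D` and `B(m, 3/4) ⊆ B(v₁, 1) ∪ B(v₂, 1) ⊆ D`).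
  [cite: LawlerSchrammWerner2004, §5.1, proof of Lemma 5.3]

## References

* G. F. Lawler, O. Schramm, W. Werner, Ann. Probab. 32 (2004) 939–995, §5.1 (proof of Lemma 5.3)
  [LawlerSchrammWerner2004].
* Ch. Pommerenke, *Boundary Behaviour of Conformal Maps*, Springer (1992), §1.2 (Schwarz–Pick),
  Cor. 1.4–1.5 [PommerenkeBBCM1992].
-/

noncomputable section

open Set Metric Complex
open scoped ComplexConjugate

namespace Literature.Probability.LatticeModels

/-! ### Two-point Schwarz–Pick for maps of a disc into the unit disc -/

/-- **Two-point Schwarz–Pick lemma, Euclidean form.** If `ψ` is holomorphic on `B(x, d)` with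
values in the unit disc, then for `z ∈ B(x, d)`:
`‖ψ z - ψ x‖ · (d - ‖z - x‖) ≤ ‖z - x‖ · (1 - ‖ψ x‖²)`. Proof: with `a = ψ x` and the disc
automorphism `φ_a(b) = (b - a)/(1 - ā b)`, Schwarz's lemma gives `‖φ_a(ψ z)‖ ≤ ‖z - x‖/d`, and
`b - a = φ_a(b) (1 - ā b)` with `‖1 - ā b‖ ≤ (1 - ‖a‖²) + ‖b - a‖`. [folklore] -/
theorem norm_sub_mul_le_of_mapsTo_ball {ψ : ℂ → ℂ} {x : ℂ} {d : ℝ} (hd : 0 < d)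
    (hψ : DifferentiableOn ℂ ψ (ball x d)) (hmaps : MapsTo ψ (ball x d) (ball 0 1)) {z : ℂ}
    (hz : z ∈ ball x d) :
    ‖ψ z - ψ x‖ * (d - ‖z - x‖) ≤ ‖z - x‖ * (1 - ‖ψ x‖ ^ 2) := by
  set a : ℂ := ψ x with ha_def
  set b : ℂ := ψ z with hb_def
  have ha : ‖a‖ < 1 := mem_ball_zero_iff.1 (hmaps (mem_ball_self hd))
  have hb : ‖b‖ < 1 := mem_ball_zero_iff.1 (hmaps hz)
  -- Schwarz's lemma for `φ_a ∘ ψ`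
  set F : ℂ → ℂ := discMobius a ∘ ψ with hF
  have hFd : DifferentiableOn ℂ F (ball x d) :=
    (differentiableOn_discMobius ha).comp hψ hmaps
  have hFx : F x = 0 := by simp [hF, ha_def]
  have hFmaps : MapsTo F (ball x d) (closedBall (F x) 1) := fun w hw ↦ by
    rw [hFx, mem_closedBall, dist_zero_right]
    exact (norm_discMobius_lt_one ha (mem_ball_zero_iff.1 (hmaps hw))).le
  have hS := dist_le_div_mul_dist_of_mapsTo_ball hFd hFmaps hz
  rw [hFx, dist_zero_right, dist_eq_norm] at hS
  -- `hS : ‖φ_a b‖ ≤ 1/d * ‖z - x‖`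
  have hT : F z = discMobius a b := rfl
  rw [hT] at hS
  have hden : 1 - conj a * b ≠ 0 := one_sub_conj_mul_ne_zero ha hb.le
  have hba : b - a = discMobius a b * (1 - conj a * b) := by
    rw [discMobius_apply, div_mul_cancel₀ _ hden]
  have h1 : ‖1 - conj a * b‖ ≤ (1 - ‖a‖ ^ 2) + ‖b - a‖ := by
    have hsplit : 1 - conj a * b = (1 - conj a * a) - conj a * (b - a) := by ring
    have hreal : (1 - conj a * a : ℂ) = ((1 - ‖a‖ ^ 2 : ℝ) : ℂ) := by
      rw [conj_mul']; push_cast; ring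
    rw [hsplit]
    calc ‖(1 - conj a * a) - conj a * (b - a)‖ ≤ ‖1 - conj a * a‖ + ‖conj a * (b - a)‖ := norm_sub_le _ _
      _ = (1 - ‖a‖ ^ 2) + ‖a‖ * ‖b - a‖ := by
          rw [hreal, Complex.norm_real, Real.norm_eq_abs, abs_of_nonneg (by nlinarith [norm_nonneg a]),
            norm_mul, Complex.norm_conj]
      _ ≤ (1 - ‖a‖ ^ 2) + ‖b - a‖ := by
          gcongr
          exact mul_le_of_le_one_left (norm_nonneg _) ha.le
  have hnorm : ‖b - a‖ = ‖discMobius a b‖ * ‖1 - conj a * b‖ := by rw [hba, norm_mul]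
  have hzx : 0 ≤ ‖z - x‖ := norm_nonneg _
  have hkey : ‖b - a‖ * d ≤ ‖z - x‖ * ((1 - ‖a‖ ^ 2) + ‖b - a‖) := by
    calc ‖b - a‖ * d = ‖discMobius a b‖ * d * ‖1 - conj a * b‖ := by rw [hnorm]; ring
      _ ≤ (1 / d * ‖z - x‖) * d * ((1 - ‖a‖ ^ 2) + ‖b - a‖) := by
          gcongr
      _ = ‖z - x‖ * ((1 - ‖a‖ ^ 2) + ‖b - a‖) := by field_simp
  nlinarith [hkey]

/-- **Conformal displacement inside the inscribed disc**: if `ψ` is holomorphic on `B(x, d)` with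
values in the unit disc and `‖z - x‖ ≤ d/2`, then `‖ψ z - ψ x‖ ≤ 1 - ‖ψ x‖²` — of the order of the
conformal distance of `x` to the boundary (the step "`α ∩ C(w, r/8) = ∅`" of the printed proof,
which uses Koebe's distortion theorem instead). [cite: LawlerSchrammWerner2004, §5.1, proof of Lemma 5.3] -/
theorem norm_sub_le_of_mapsTo_ball_half {ψ : ℂ → ℂ} {x : ℂ} {d : ℝ} (hd : 0 < d)
    (hψ : DifferentiableOn ℂ ψ (ball x d)) (hmaps : MapsTo ψ (ball x d) (ball 0 1)) {z : ℂ}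
    (hz : ‖z - x‖ ≤ d / 2) : ‖ψ z - ψ x‖ ≤ 1 - ‖ψ x‖ ^ 2 := by
  have hzb : z ∈ ball x d := by rw [mem_ball, dist_eq_norm]; linarith
  have h := norm_sub_mul_le_of_mapsTo_ball hd hψ hmaps hzb
  have ha : ‖ψ x‖ < 1 := mem_ball_zero_iff.1 (hmaps (mem_ball_self hd))
  have h1 : 0 ≤ 1 - ‖ψ x‖ ^ 2 := by nlinarith [norm_nonneg (ψ x)]
  have h2 : d / 2 ≤ d - ‖z - x‖ := by linarith
  by_contra hlt
  push Not at hlt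
  have : ‖z - x‖ * (1 - ‖ψ x‖ ^ 2) < ‖ψ z - ψ x‖ * (d - ‖z - x‖) :=
    calc ‖z - x‖ * (1 - ‖ψ x‖ ^ 2) ≤ d / 2 * (1 - ‖ψ x‖ ^ 2) := by gcongr
      _ < d / 2 * ‖ψ z - ψ x‖ := by gcongr
      _ ≤ (d - ‖z - x‖) * ‖ψ z - ψ x‖ := by gcongr
      _ = ‖ψ z - ψ x‖ * (d - ‖z - x‖) := by ring
  linarith

/-- The same with an explicit fraction `s < 1` of the radius: for `‖z - x‖ ≤ s d`,
`‖ψ z - ψ x‖ (1 - s) ≤ s (1 - ‖ψ x‖²)`. [folklore] -/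
theorem norm_sub_le_of_mapsTo_ball_frac {ψ : ℂ → ℂ} {x : ℂ} {d s : ℝ} (hd : 0 < d) (hs : s < 1)
    (hψ : DifferentiableOn ℂ ψ (ball x d)) (hmaps : MapsTo ψ (ball x d) (ball 0 1)) {z : ℂ}
    (hz : ‖z - x‖ ≤ s * d) : ‖ψ z - ψ x‖ * (1 - s) ≤ s * (1 - ‖ψ x‖ ^ 2) := by
  have hzb : z ∈ ball x d := by
    rw [mem_ball, dist_eq_norm]
    calc ‖z - x‖ ≤ s * d := hz
      _ < 1 * d := by gcongr
      _ = d := one_mul d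
  have h := norm_sub_mul_le_of_mapsTo_ball hd hψ hmaps hzb
  have ha : ‖ψ x‖ < 1 := mem_ball_zero_iff.1 (hmaps (mem_ball_self hd))
  have h1 : 0 ≤ 1 - ‖ψ x‖ ^ 2 := by nlinarith [norm_nonneg (ψ x)]
  have h2 : (1 - s) * d ≤ d - ‖z - x‖ := by linarith
  have h3 : ‖ψ z - ψ x‖ * ((1 - s) * d) ≤ s * d * (1 - ‖ψ x‖ ^ 2) :=
    calc ‖ψ z - ψ x‖ * ((1 - s) * d) ≤ ‖ψ z - ψ x‖ * (d - ‖z - x‖) := by gcongr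
      _ ≤ ‖z - x‖ * (1 - ‖ψ x‖ ^ 2) := h
      _ ≤ s * d * (1 - ‖ψ x‖ ^ 2) := by gcongr
  have h4 : (‖ψ z - ψ x‖ * (1 - s)) * d ≤ (s * (1 - ‖ψ x‖ ^ 2)) * d := by
    calc (‖ψ z - ψ x‖ * (1 - s)) * d = ‖ψ z - ψ x‖ * ((1 - s) * d) := by ring
      _ ≤ s * d * (1 - ‖ψ x‖ ^ 2) := h3
      _ = (s * (1 - ‖ψ x‖ ^ 2)) * d := by ring
  exact le_of_mul_le_mul_right h4 hd

/-! ### Grid geometry: lattice points, grid edges, and the unit disc about a lattice point -/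

namespace LSWGrid

/-- The unit vector `e₀ ↦ 1`. [folklore] -/
theorem toComplex_single_zero : Site.toComplex (Pi.single (0 : Fin 2) 1 : Site 2) = 1 := by
  apply Complex.ext <;> simp [Site.toComplex]

/-- The unit vector `e₁ ↦ i`. [folklore] -/
theorem toComplex_single_one : Site.toComplex (Pi.single (1 : Fin 2) 1 : Site 2) = Complex.I := by
  apply Complex.ext <;> simp [Site.toComplex]

/-- A nonzero integer has absolute value at least one (real form). [folklore] -/
theorem one_le_abs_intCast_of_ne {n : ℤ} (h : n ≠ 0) : (1 : ℝ) ≤ |(n : ℝ)| := by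
  have := Int.one_le_abs h
  exact_mod_cast this

/-- **A point of the grid edge from `a` to `a + eᵢ` is at distance `≥ 1` from every lattice point
other than its two ends.** [folklore] -/
theorem one_le_dist_of_mem_segment_single {a x : Site 2} (i : Fin 2) (hxa : x ≠ a)
    (hxb : x ≠ a + Pi.single i 1) {p : ℂ}
    (hp : p ∈ segment ℝ (Site.toComplex a) (Site.toComplex (a + Pi.single i 1))) :
    1 ≤ dist p (Site.toComplex x) := by
  -- (`Site.toComplex` is additive; sites are determined by their two coordinates —
  -- `Literature.Probability.Percolation.toComplex_add`, `….Contour.site_ext`, not imported here)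
  have toComplex_add : ∀ x y : Site 2, Site.toComplex (x + y) = Site.toComplex x + Site.toComplex y :=
    fun x y => by apply Complex.ext <;> simp [Site.toComplex]
  have site_eq_of_apply_eq : ∀ {x y : Site 2}, x 0 = y 0 → x 1 = y 1 → x = y :=
    fun h0 h1 => by funext i; fin_cases i <;> assumption
  rw [segment_eq_image'] at hp
  obtain ⟨t, ⟨ht0, ht1⟩, rfl⟩ := hp
  rw [dist_eq_norm, toComplex_add, add_sub_cancel_left]
  fin_cases i
  · -- horizontal edge: `p = a + t`
    simp only [Fin.zero_eta, toComplex_single_zero]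
    set q : ℂ := Site.toComplex a + t • (1 : ℂ) - Site.toComplex x with hq
    have hre : q.re = (a 0 : ℝ) + t - x 0 := by simp [hq, Site.toComplex]
    have him : q.im = (a 1 : ℝ) - x 1 := by simp [hq, Site.toComplex]
    by_cases h1 : a 1 = x 1
    · -- same row: `x 0 ∉ {a 0, a 0 + 1}`
      have h0a : x 0 ≠ a 0 := fun h => hxa (site_eq_of_apply_eq h h1.symm)
      have h0b : x 0 ≠ a 0 + 1 := fun h => hxb (site_eq_of_apply_eq (by simpa using h) (by simpa using h1.symm))
      have hcases : x 0 ≤ a 0 - 1 ∨ a 0 + 2 ≤ x 0 := by omega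
      refine le_trans ?_ (Complex.abs_re_le_norm q)
      rw [hre]
      rcases hcases with h | h
      · have : (x 0 : ℝ) ≤ a 0 - 1 := by exact_mod_cast h
        rw [le_abs]; left; linarith
      · have : (a 0 : ℝ) + 2 ≤ x 0 := by exact_mod_cast h
        rw [le_abs]; right; linarith
    · refine le_trans ?_ (Complex.abs_im_le_norm q)
      rw [him, ← Int.cast_sub]
      exact one_le_abs_intCast_of_ne (sub_ne_zero.2 h1)
  · -- vertical edge: `p = a + t i`
    simp only [Fin.mk_one, toComplex_single_one]
    set q : ℂ := Site.toComplex a + t • Complex.I - Site.toComplex x with hq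
    have hre : q.re = (a 0 : ℝ) - x 0 := by simp [hq, Site.toComplex]
    have him : q.im = (a 1 : ℝ) + t - x 1 := by simp [hq, Site.toComplex]
    by_cases h0 : a 0 = x 0
    · have h1a : x 1 ≠ a 1 := fun h => hxa (site_eq_of_apply_eq h0.symm h)
      have h1b : x 1 ≠ a 1 + 1 := fun h => hxb (site_eq_of_apply_eq (by simpa using h0.symm) (by simpa using h))
      have hcases : x 1 ≤ a 1 - 1 ∨ a 1 + 2 ≤ x 1 := by omega
      refine le_trans ?_ (Complex.abs_im_le_norm q)
      rw [him]
      rcases hcases with h | h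
      · have : (x 1 : ℝ) ≤ a 1 - 1 := by exact_mod_cast h
        rw [le_abs]; left; linarith
      · have : (a 1 : ℝ) + 2 ≤ x 1 := by exact_mod_cast h
        rw [le_abs]; right; linarith
    · refine le_trans ?_ (Complex.abs_re_le_norm q)
      rw [hre, ← Int.cast_sub]
      exact one_le_abs_intCast_of_ne (sub_ne_zero.2 h0)

/-- **A point of a grid edge `[a, b]`, `a ∼ b`, is at distance `≥ 1` from every lattice point
`x ∉ {a, b}`.** [folklore] -/
theorem one_le_dist_of_mem_segment {a b x : Site 2} (hab : (zdGraph 2).Adj a b) (hxa : x ≠ a)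
    (hxb : x ≠ b) {p : ℂ} (hp : p ∈ segment ℝ (Site.toComplex a) (Site.toComplex b)) :
    1 ≤ dist p (Site.toComplex x) := by
  obtain ⟨i, h | h⟩ := (zdGraph_adj_iff a b).1 hab
  · subst h
    exact one_le_dist_of_mem_segment_single i hxa hxb hp
  · subst h
    rw [segment_symm] at hp
    exact one_le_dist_of_mem_segment_single i hxb hxa hp

/-- Lattice neighbours are at Euclidean distance `1`. [folklore] -/
theorem norm_toComplex_sub_of_adj {x y : Site 2} (h : (zdGraph 2).Adj x y) :
    ‖Site.toComplex y - Site.toComplex x‖ = 1 := by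
  have toComplex_add : ∀ x y : Site 2, Site.toComplex (x + y) = Site.toComplex x + Site.toComplex y :=
    fun x y => by apply Complex.ext <;> simp [Site.toComplex]
  obtain ⟨i, h | h⟩ := (zdGraph_adj_iff x y).1 h
  · subst h
    rw [toComplex_add, add_sub_cancel_left]
    fin_cases i
    · simp [toComplex_single_zero]
    · simp [toComplex_single_one]
  · subst h
    rw [toComplex_add, sub_add_cancel_left, norm_neg]
    fin_cases i
    · simp [toComplex_single_zero]
    · simp [toComplex_single_one]

variable {D : Set ℂ}

/-- For a grid domain, the end-points of the boundary edges lie on the boundary, hence outside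
`D`. [folklore] -/
theorem IsGridDomain.frontier_subset_compl (hD : IsGridDomain D) : frontier D ⊆ Dᶜ := fun _ hp hpD =>
  hp.2 (by rwa [hD.1.interior_eq])

/-- **The open unit disc about a lattice point of a grid domain lies in the domain**
(`dist(v, ∂D) ≥ 1` for `v ∈ V(D)`): the boundary consists of grid edges not ending at `v`, each at
distance `≥ 1` from `v`, and the disc is connected. [folklore] -/
theorem IsGridDomain.ball_one_subset (hD : IsGridDomain D) {x : Site 2} (hx : x ∈ latticeVertices D) :
    ball (Site.toComplex x) 1 ⊆ D := by
  obtain ⟨hopen, -, E, hE, hfront⟩ := hD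
  refine (convex_ball _ _).isPreconnected.subset_of_closure_inter_subset hopen
    ⟨_, mem_ball_self one_pos, hx⟩ ?_
  rintro p ⟨hpcl, hpball⟩
  by_contra hpD
  have hpfr : p ∈ frontier D := ⟨hpcl, fun h => hpD (interior_subset h)⟩
  rw [hfront] at hpfr
  obtain ⟨e, heE, hpe⟩ := mem_iUnion₂.1 hpfr
  have h1 : Site.toComplex e.1 ∈ frontier D := by
    rw [hfront]; exact mem_iUnion₂.2 ⟨e, heE, left_mem_segment _ _ _⟩
  have h2 : Site.toComplex e.2 ∈ frontier D := by
    rw [hfront]; exact mem_iUnion₂.2 ⟨e, heE, right_mem_segment _ _ _⟩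
  have hx1 : x ≠ e.1 := fun h => h1.2 (by rw [hopen.interior_eq, ← h]; exact hx)
  have hx2 : x ≠ e.2 := fun h => h2.2 (by rw [hopen.interior_eq, ← h]; exact hx)
  have hdist := one_le_dist_of_mem_segment (hE e heE) hx1 hx2 hpe
  rw [mem_ball] at hpball
  linarith

/-- Lattice points of a grid domain are at distance `≥ 1` from its complement. [folklore] -/
theorem IsGridDomain.one_le_norm_sub_of_not_mem (hD : IsGridDomain D) {x : Site 2}
    (hx : x ∈ latticeVertices D) {b : ℂ} (hb : b ∉ D) : 1 ≤ ‖b - Site.toComplex x‖ := by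
  by_contra hlt
  push Not at hlt
  exact hb (hD.ball_one_subset hx (by rwa [mem_ball, dist_eq_norm]))

/-- **A lattice neighbour outside `D` of a lattice point of `D` lies on `∂D`**: the walk on `V(D)`
killed at its first step out of `V(D)` is the walk stopped on `∂D`. (The edge meets `∂D`, at a
point of a boundary grid edge; that point is at distance `≥ 1` from the inner end, so it is the
outer end.) [cite: LawlerSchrammWerner2004, §2.2] -/
theorem IsGridDomain.toComplex_mem_frontier (hD : IsGridDomain D) {x y : Site 2}
    (hx : x ∈ latticeVertices D) (hxy : (zdGraph 2).Adj x y) (hy : y ∉ latticeVertices D) :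
    Site.toComplex y ∈ frontier D := by
  have hopen := hD.1
  obtain ⟨E, hE, hfront⟩ := hD.2.2
  -- the edge meets the frontier
  have hmeet : (segment ℝ (Site.toComplex x) (Site.toComplex y) ∩ frontier D).Nonempty := by
    by_contra hempty
    rw [not_nonempty_iff_eq_empty] at hempty
    have hsub : segment ℝ (Site.toComplex x) (Site.toComplex y) ⊆ D := by
      refine (convex_segment _ _).isPreconnected.subset_of_closure_inter_subset hopen
        ⟨_, left_mem_segment _ _ _, hx⟩ ?_
      rintro p ⟨hpcl, hpseg⟩
      by_contra hpD
      have : p ∈ segment ℝ (Site.toComplex x) (Site.toComplex y) ∩ frontier D :=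
        ⟨hpseg, hpcl, fun h => hpD (interior_subset h)⟩
      rw [hempty] at this
      exact this
    exact hy (hsub (right_mem_segment _ _ _))
  obtain ⟨p, hpseg, hpfr⟩ := hmeet
  have hpfr' := hpfr
  rw [hfront] at hpfr'
  obtain ⟨e, heE, hpe⟩ := mem_iUnion₂.1 hpfr'
  have h1 : Site.toComplex e.1 ∈ frontier D := by
    rw [hfront]; exact mem_iUnion₂.2 ⟨e, heE, left_mem_segment _ _ _⟩
  have h2 : Site.toComplex e.2 ∈ frontier D := by
    rw [hfront]; exact mem_iUnion₂.2 ⟨e, heE, right_mem_segment _ _ _⟩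
  have hx1 : x ≠ e.1 := fun h => h1.2 (by rw [hopen.interior_eq, ← h]; exact hx)
  have hx2 : x ≠ e.2 := fun h => h2.2 (by rw [hopen.interior_eq, ← h]; exact hx)
  have hdist := one_le_dist_of_mem_segment (hE e heE) hx1 hx2 hpe
  -- `p = x + t (y - x)` with `t ≤ 1` and `dist p x = t ≥ 1`, so `p = y`
  rw [segment_eq_image'] at hpseg
  obtain ⟨t, ⟨ht0, ht1⟩, rfl⟩ := hpseg
  rw [dist_eq_norm, add_sub_cancel_left, norm_smul, Real.norm_eq_abs, abs_of_nonneg ht0,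
    norm_toComplex_sub_of_adj hxy, mul_one] at hdist
  have ht : t = 1 := le_antisymm ht1 hdist
  simpa [ht] using hpfr

/-! ### Lattice steps in conformal coordinates -/

/-- The disc of radius `3/4` about the midpoint of a unit segment lies in the union of the unit
discs about its ends. [folklore] -/
theorem ball_midpoint_subset {x y : ℂ} (hxy : ‖y - x‖ = 1) :
    ball ((2⁻¹ : ℝ) • (x + y)) (3 / 4) ⊆ ball x 1 ∪ ball y 1 := by
  intro z hz
  rw [mem_ball, dist_eq_norm] at hz
  set m : ℂ := (2⁻¹ : ℝ) • (x + y) with hm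
  have hpar : ‖z - x‖ ^ 2 + ‖z - y‖ ^ 2 = 2 * ‖z - m‖ ^ 2 + ‖y - x‖ ^ 2 / 2 := by
    simp only [Complex.sq_norm, Complex.normSq_apply, Complex.sub_re, Complex.sub_im, hm,
      Complex.smul_re, Complex.smul_im, Complex.add_re, Complex.add_im]
    ring
  rw [hxy] at hpar
  have hzm : ‖z - m‖ ^ 2 < (3 / 4) ^ 2 := by
    exact pow_lt_pow_left₀ hz (norm_nonneg _) two_ne_zero
  by_contra hnot
  simp only [mem_union, mem_ball, dist_eq_norm, not_or, not_lt] at hnot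
  have h1 : 1 ≤ ‖z - x‖ ^ 2 := by nlinarith [hnot.1]
  have h2 : 1 ≤ ‖z - y‖ ^ 2 := by nlinarith [hnot.2]
  nlinarith

/-- The midpoint is at distance `1/2` from each end of a unit segment. [folklore] -/
theorem norm_midpoint_sub {x y : ℂ} (hxy : ‖y - x‖ = 1) :
    ‖(2⁻¹ : ℝ) • (x + y) - x‖ = 1 / 2 ∧ ‖y - (2⁻¹ : ℝ) • (x + y)‖ = 1 / 2 := by
  have h1 : (2⁻¹ : ℝ) • (x + y) - x = (2⁻¹ : ℝ) • (y - x) := by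
    simp only [smul_sub, smul_add]; module
  have h2 : y - (2⁻¹ : ℝ) • (x + y) = (2⁻¹ : ℝ) • (y - x) := by
    simp only [smul_sub, smul_add]; module
  rw [h1, h2, norm_smul, hxy]
  norm_num

/-- **Neighbouring lattice points have comparable conformal coordinates** (the step "if
`v₁, v₂ ∈ V(D)` are neighbors, then `1 - |ψ_D(v₂)| ≤ c (1 - |ψ_D(v₁)|)`" of the printed proof, in
the stronger displacement form): for a grid domain `D`, a holomorphic `ψ : D → 𝔻` and lattice
neighbours `v₁, v₂ ∈ V(D)`, `‖ψ v₂ - ψ v₁‖ ≤ 14 (1 - ‖ψ v₁‖)`. Proof: two Schwarz–Pick steps,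
from `v₁` to the midpoint `m` inside `B(v₁, 1) ⊆ D`, and from `m` to `v₂` inside
`B(m, 3/4) ⊆ B(v₁,1) ∪ B(v₂,1) ⊆ D`. [cite: LawlerSchrammWerner2004, §5.1, proof of Lemma 5.3] -/
theorem IsGridDomain.norm_sub_le_of_adj (hD : IsGridDomain D) {ψ : ℂ → ℂ}
    (hψ : DifferentiableOn ℂ ψ D) (hmaps : MapsTo ψ D (ball 0 1)) {v₁ v₂ : Site 2}
    (h₁ : v₁ ∈ latticeVertices D) (h₂ : v₂ ∈ latticeVertices D) (hadj : (zdGraph 2).Adj v₁ v₂) :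
    ‖ψ (Site.toComplex v₂) - ψ (Site.toComplex v₁)‖ ≤ 14 * (1 - ‖ψ (Site.toComplex v₁)‖) := by
  set x := Site.toComplex v₁ with hx
  set y := Site.toComplex v₂ with hy
  have hxy : ‖y - x‖ = 1 := norm_toComplex_sub_of_adj hadj
  set m : ℂ := (2⁻¹ : ℝ) • (x + y) with hm
  have hBx : ball x 1 ⊆ D := hD.ball_one_subset h₁
  have hBy : ball y 1 ⊆ D := hD.ball_one_subset h₂
  have hBm : ball m (3 / 4) ⊆ D := (ball_midpoint_subset hxy).trans (union_subset hBx hBy)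
  obtain ⟨hmx, hym⟩ := norm_midpoint_sub hxy
  have hψx : ‖ψ x‖ < 1 := mem_ball_zero_iff.1 (hmaps (hBx (mem_ball_self one_pos)))
  have hψm : ‖ψ m‖ < 1 := mem_ball_zero_iff.1 (hmaps (hBm (mem_ball_self (by norm_num))))
  -- step 1: `x → m`
  have hstep1 : ‖ψ m - ψ x‖ ≤ 1 - ‖ψ x‖ ^ 2 :=
    norm_sub_le_of_mapsTo_ball_half one_pos (hψ.mono hBx) (hmaps.mono_left hBx) hmx.le
  -- step 2: `m → y`, fraction `s = 2/3` of the radius `3/4`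
  have hstep2 : ‖ψ y - ψ m‖ * (1 - 2 / 3) ≤ 2 / 3 * (1 - ‖ψ m‖ ^ 2) :=
    norm_sub_le_of_mapsTo_ball_frac (by norm_num) (by norm_num) (hψ.mono hBm) (hmaps.mono_left hBm)
      (by rw [hym]; norm_num)
  have hux : 1 - ‖ψ x‖ ^ 2 ≤ 2 * (1 - ‖ψ x‖) := by nlinarith [norm_nonneg (ψ x), sq_nonneg (1 - ‖ψ x‖)]
  have hum : 1 - ‖ψ m‖ ^ 2 ≤ 2 * (1 - ‖ψ m‖) := by nlinarith [norm_nonneg (ψ m), sq_nonneg (1 - ‖ψ m‖)]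
  have hm_le : 1 - ‖ψ m‖ ≤ 3 * (1 - ‖ψ x‖) := by
    have : ‖ψ x‖ ≤ ‖ψ m‖ + ‖ψ m - ψ x‖ := by
      calc ‖ψ x‖ = ‖ψ m - (ψ m - ψ x)‖ := by ring_nf
        _ ≤ ‖ψ m‖ + ‖ψ m - ψ x‖ := norm_sub_le _ _
    linarith
  have h2' : ‖ψ y - ψ m‖ ≤ 12 * (1 - ‖ψ x‖) := by nlinarith
  calc ‖ψ y - ψ x‖ = ‖(ψ y - ψ m) + (ψ m - ψ x)‖ := by ring_nf
    _ ≤ ‖ψ y - ψ m‖ + ‖ψ m - ψ x‖ := norm_add_le _ _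
    _ ≤ 12 * (1 - ‖ψ x‖) + 2 * (1 - ‖ψ x‖) := add_le_add h2' (hstep1.trans hux)
    _ = 14 * (1 - ‖ψ x‖) := by ring

/-- **Neighbouring lattice points have comparable conformal distances to the boundary**:
`1 - ‖ψ v₂‖ ≤ 15 (1 - ‖ψ v₁‖)` for lattice neighbours `v₁, v₂ ∈ V(D)` of a grid domain and a
holomorphic `ψ : D → 𝔻` ("there is a constant `c > 0` such that if `v₁, v₂ ∈ V(D)` are neighbors,
then `1 - |ψ_D(v₂)| ≤ c (1 - |ψ_D(v₁)|)`"). [cite: LawlerSchrammWerner2004, §5.1, proof of Lemma 5.3] -/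
theorem IsGridDomain.one_sub_norm_le_of_adj (hD : IsGridDomain D) {ψ : ℂ → ℂ}
    (hψ : DifferentiableOn ℂ ψ D) (hmaps : MapsTo ψ D (ball 0 1)) {v₁ v₂ : Site 2}
    (h₁ : v₁ ∈ latticeVertices D) (h₂ : v₂ ∈ latticeVertices D) (hadj : (zdGraph 2).Adj v₁ v₂) :
    1 - ‖ψ (Site.toComplex v₂)‖ ≤ 15 * (1 - ‖ψ (Site.toComplex v₁)‖) := by
  have h := hD.norm_sub_le_of_adj hψ hmaps h₁ h₂ hadj
  have : ‖ψ (Site.toComplex v₁)‖ ≤ ‖ψ (Site.toComplex v₂)‖ + ‖ψ (Site.toComplex v₂) - ψ (Site.toComplex v₁)‖ := by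
    calc ‖ψ (Site.toComplex v₁)‖ = ‖ψ (Site.toComplex v₂) - (ψ (Site.toComplex v₂) - ψ (Site.toComplex v₁))‖ := by
          ring_nf
      _ ≤ _ := norm_sub_le _ _
  linarith

/-- **Conformal displacement near a lattice point of `D`**: for `v ∈ V(D)` with `B(v, R) ⊆ D` and
`‖z - v‖ ≤ R/2`, `‖ψ z - ψ v‖ ≤ 1 - ‖ψ v‖² ≤ 2 (1 - ‖ψ v‖)` — points of the inner half of the
inscribed disc are conformally within twice the conformal distance of `v` to the boundary (so the
level set `{|ψ - ψ(v)| = ε₁}` misses that disc as soon as `2 (1 - |ψ(v)|) < ε₁`).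
[cite: LawlerSchrammWerner2004, §5.1, proof of Lemma 5.3] -/
theorem norm_sub_le_two_mul_of_ball_subset {ψ : ℂ → ℂ} (hψ : DifferentiableOn ℂ ψ D)
    (hmaps : MapsTo ψ D (ball 0 1)) {v z : ℂ} {R : ℝ} (hR : 0 < R) (hball : ball v R ⊆ D)
    (hz : ‖z - v‖ ≤ R / 2) : ‖ψ z - ψ v‖ ≤ 2 * (1 - ‖ψ v‖) := by
  have h := norm_sub_le_of_mapsTo_ball_half hR (hψ.mono hball) (hmaps.mono_left hball) hz
  nlinarith [norm_nonneg (ψ v), sq_nonneg (1 - ‖ψ v‖)]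

end LSWGrid

end Literature.Probability.LatticeModels
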